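import Mathlib

/-!
# SoloBlindUntwist — kernel anchor for LieExponent §3.25 (untwisting; Theorem 13; (Q_L7) negative)

Door L (Lie-group TPP submanifold triples).  Over a SUBGROUP pair `(H₂, H₃)` the TPP condition for a
third member `M` reads `M M⁻¹ ∩ H₃H₂ = {1}`.  Lemma 3.25(b) of the solo-blind paper observes that this
condition survives a *gauge* `m ↦ u(m)⁻¹ m` with `u(m) ∈ H₂` normalising `H₃` (mechanism M2) or lying in
a subgroup normalised by the characteristic group (mechanism M1): if the gauged difference
`a = (u'⁻¹ m') (u⁻¹ m)⁻¹` lies in `H₃H₂` then `m = m'`.  We record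

* the four purely group-theoretic TRANSFER lemmas behind Lemma 3.25(b)(3) (gauge in `H₂` or in `H₃`,
  mechanisms M1 and M2);
* the TWISTED ISOTROPY identity of Lemma 3.25(c) (orbit-tangential motion of the annihilator makes the
  gauged tangent space isotropic);
* the counting of Theorem 13 (two slices + (13.0) force `2·dim(slice) ≤ a − 1`, whence
  `d₁ ≤ d/2 − 1` untwisted and `d₁ ≤ 7`, `Σ ≤ 21` in `GL₄(ℝ)`), and the finite table of invariant
  signatures met by the exact-arithmetic census (Cor. 13.2).

All statements are elementary; they are the load-bearing algebra of the pen-proofs, not the analysis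
(linear ODE uniqueness, Cauchy characteristics), which stays on paper.
-/

set_option linter.dupNamespace false

namespace Summit.MatrixMultiplication.MatrixMultiplication.Theorems

section Transfer

variable {G : Type*} [Group G]

/-- Lemma 3.25(b)(3), gauge in `H₂`, mechanism (M2): `u, u' ∈ H₂`, `u'` normalises `H₃`.
If the gauged difference `a = (u'⁻¹ m')(u⁻¹ m)⁻¹` lies in `H₃H₂`, TPP forces `m = m'`. -/
theorem soloLie_untwist_transfer_M2 (H₂ H₃ : Subgroup G) (M : Set G)
    (htpp : ∀ m ∈ M, ∀ m' ∈ M, (∃ h₃ ∈ H₃, ∃ h₂ ∈ H₂, m' * m⁻¹ = h₃ * h₂) → m = m')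
    (u u' m m' a : G) (hm : m ∈ M) (hm' : m' ∈ M)
    (hadef : a = (u'⁻¹ * m') * (u⁻¹ * m)⁻¹)
    (hu : u ∈ H₂) (hu' : u' ∈ H₂) (hn : ∀ h ∈ H₃, u' * h * u'⁻¹ ∈ H₃)
    (ha : ∃ h₃ ∈ H₃, ∃ h₂ ∈ H₂, a = h₃ * h₂) : m = m' := by
  obtain ⟨h₃, hh₃, h₂, hh₂, hprod⟩ := ha
  apply htpp m hm m' hm'
  refine ⟨u' * h₃ * u'⁻¹, hn h₃ hh₃, u' * h₂ * u⁻¹,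
    H₂.mul_mem (H₂.mul_mem hu' hh₂) (H₂.inv_mem hu), ?_⟩
  have key : m' * m⁻¹ = u' * a * u⁻¹ := by rw [hadef]; group
  rw [key, hprod]; group

/-- Lemma 3.25(b)(3), gauge in `H₂`, mechanism (M1): `u ∈ H₂` and `a⁻¹ u' a ∈ H₂`
(the characteristic group normalises the gauge subgroup `B' ∋ u'`).  Same conclusion. -/
theorem soloLie_untwist_transfer_M1 (H₂ H₃ : Subgroup G) (M : Set G)
    (htpp : ∀ m ∈ M, ∀ m' ∈ M, (∃ h₃ ∈ H₃, ∃ h₂ ∈ H₂, m' * m⁻¹ = h₃ * h₂) → m = m')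
    (u u' m m' a : G) (hm : m ∈ M) (hm' : m' ∈ M)
    (hadef : a = (u'⁻¹ * m') * (u⁻¹ * m)⁻¹)
    (hu : u ∈ H₂) (hnorm : a⁻¹ * u' * a ∈ H₂)
    (ha : ∃ h₃ ∈ H₃, ∃ h₂ ∈ H₂, a = h₃ * h₂) : m = m' := by
  obtain ⟨h₃, hh₃, h₂, hh₂, hprod⟩ := ha
  apply htpp m hm m' hm'
  refine ⟨h₃, hh₃, h₂ * (a⁻¹ * u' * a) * u⁻¹,
    H₂.mul_mem (H₂.mul_mem hh₂ hnorm) (H₂.inv_mem hu), ?_⟩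
  have key : m' * m⁻¹ = a * (a⁻¹ * u' * a) * u⁻¹ := by rw [hadef]; group
  rw [key, hprod]; group

/-- Lemma 3.25(b)(3), gauge in `H₃`, mechanism (M2): `u, u' ∈ H₃`, `u'` normalises `H₂`.
If `a⁻¹ ∈ H₃H₂` then TPP (applied to `m m'⁻¹`) forces `m' = m`. -/
theorem soloLie_untwist_transfer_M2' (H₂ H₃ : Subgroup G) (M : Set G)
    (htpp : ∀ m ∈ M, ∀ m' ∈ M, (∃ h₃ ∈ H₃, ∃ h₂ ∈ H₂, m' * m⁻¹ = h₃ * h₂) → m = m')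
    (u u' m m' a : G) (hm : m ∈ M) (hm' : m' ∈ M)
    (hadef : a = (u'⁻¹ * m') * (u⁻¹ * m)⁻¹)
    (hu : u ∈ H₃) (hu' : u' ∈ H₃) (hn : ∀ h ∈ H₂, u' * h * u'⁻¹ ∈ H₂)
    (ha : ∃ h₃ ∈ H₃, ∃ h₂ ∈ H₂, a⁻¹ = h₃ * h₂) : m' = m := by
  obtain ⟨h₃, hh₃, h₂, hh₂, hprod⟩ := ha
  apply htpp m' hm' m hm
  refine ⟨u * h₃ * u'⁻¹, H₃.mul_mem (H₃.mul_mem hu hh₃) (H₃.inv_mem hu'), u' * h₂ * u'⁻¹,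
    hn h₂ hh₂, ?_⟩
  have key : m * m'⁻¹ = u * a⁻¹ * u'⁻¹ := by rw [hadef]; group
  rw [key, hprod]; group

/-- Lemma 3.25(b)(3), gauge in `H₃`, mechanism (M1): `u ∈ H₃` and `a⁻¹ u'⁻¹ a ∈ H₃`
(the characteristic group normalises the gauge subgroup inside `H₃`).  If `a⁻¹ ∈ H₃H₂` then `m' = m`. -/
theorem soloLie_untwist_transfer_M1' (H₂ H₃ : Subgroup G) (M : Set G)
    (htpp : ∀ m ∈ M, ∀ m' ∈ M, (∃ h₃ ∈ H₃, ∃ h₂ ∈ H₂, m' * m⁻¹ = h₃ * h₂) → m = m')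
    (u u' m m' a : G) (hm : m ∈ M) (hm' : m' ∈ M)
    (hadef : a = (u'⁻¹ * m') * (u⁻¹ * m)⁻¹)
    (hu : u ∈ H₃) (hnorm : a⁻¹ * u'⁻¹ * a ∈ H₃)
    (ha : ∃ h₃ ∈ H₃, ∃ h₂ ∈ H₂, a⁻¹ = h₃ * h₂) : m' = m := by
  obtain ⟨h₃, hh₃, h₂, hh₂, hprod⟩ := ha
  apply htpp m' hm' m hm
  refine ⟨u * (a⁻¹ * u'⁻¹ * a) * h₃, H₃.mul_mem (H₃.mul_mem hu hnorm) hh₃, h₂, hh₂, ?_⟩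
  have key : m * m'⁻¹ = u * (a⁻¹ * u'⁻¹ * a) * a⁻¹ := by rw [hadef]; group
  rw [key, hprod]; group

/-- The product set `H₃H₂` is two-sided stable: left multiplication by `H₃` and right multiplication by
`H₂` preserve it (the reason internal gauges are free, Remark 13.4(1)). -/
theorem soloLie_untwist_H3H2_stable (H₂ H₃ : Subgroup G) (g x y : G) (hx : x ∈ H₃) (hy : y ∈ H₂)
    (hg : ∃ h₃ ∈ H₃, ∃ h₂ ∈ H₂, g = h₃ * h₂) :
    ∃ h₃ ∈ H₃, ∃ h₂ ∈ H₂, x * g * y = h₃ * h₂ := by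
  obtain ⟨h₃, hh₃, h₂, hh₂, rfl⟩ := hg
  exact ⟨x * h₃, H₃.mul_mem hx hh₃, h₂ * y, H₂.mul_mem hh₂ hy, by group⟩

end Transfer

section Isotropy

/-- Lemma 3.25(c) (twisted isotropy, one gauge direction): if the alternating form `ω = ω_ν` satisfies
Lemma A's identity with orbit-tangential motion, `ω(v,v') = ℓ(v)·ω(y,v') − ℓ(v')·ω(y,v)`, then the gauged
vectors `v − ℓ(v)y`, `v' − ℓ(v')y` are `ω`-orthogonal: the gauged tangent space is isotropic. -/
theorem soloLie_untwist_isotropic {E : Type*} [AddCommGroup E] [Module ℝ E]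
    (ω : E →ₗ[ℝ] E →ₗ[ℝ] ℝ) (halt : ∀ a b : E, ω a b = - ω b a) (ℓ : E →ₗ[ℝ] ℝ) (y v v' : E)
    (h : ω v v' = ℓ v * ω y v' - ℓ v' * ω y v) :
    ω (v - ℓ v • y) (v' - ℓ v' • y) = 0 := by
  have hyy : ω y y = 0 := by have := halt y y; linarith
  have hvy : ω v y = - ω y v := halt v y
  simp only [map_sub, map_smul, LinearMap.sub_apply, LinearMap.smul_apply, smul_eq_mul]
  rw [h, hvy, hyy]; ring

/-- Two commuting gauge directions (`ω(y₁,y₂) = 0`, e.g. an abelian gauge): the same conclusion for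
`v − ℓ₁(v)y₁ − ℓ₂(v)y₂` (Lemma 3.25(c), case R = 2). -/
theorem soloLie_untwist_isotropic_two {E : Type*} [AddCommGroup E] [Module ℝ E]
    (ω : E →ₗ[ℝ] E →ₗ[ℝ] ℝ) (halt : ∀ a b : E, ω a b = - ω b a) (ℓ₁ ℓ₂ : E →ₗ[ℝ] ℝ)
    (y₁ y₂ v v' : E) (hcomm : ω y₁ y₂ = 0)
    (h : ω v v' = ℓ₁ v * ω y₁ v' - ℓ₁ v' * ω y₁ v + (ℓ₂ v * ω y₂ v' - ℓ₂ v' * ω y₂ v)) :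
    ω (v - ℓ₁ v • y₁ - ℓ₂ v • y₂) (v' - ℓ₁ v' • y₁ - ℓ₂ v' • y₂) = 0 := by
  have h11 : ω y₁ y₁ = 0 := by have := halt y₁ y₁; linarith
  have h22 : ω y₂ y₂ = 0 := by have := halt y₂ y₂; linarith
  have h21 : ω y₂ y₁ = 0 := by rw [halt, hcomm]; simp
  have hv1 : ω v y₁ = - ω y₁ v := halt v y₁
  have hv2 : ω v y₂ = - ω y₂ v := halt v y₂
  simp only [map_sub, map_smul, LinearMap.sub_apply, LinearMap.smul_apply, smul_eq_mul]
  rw [h, hv1, hv2, h11, h22, h21, hcomm]; ring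

end Isotropy

section Counting

/-- (13.0): isotropy of `𝔥₂, 𝔥₃` in `ker λ` gives `2kᵢ + ρ ≥ 2dᵢ`; with `d₂ + d₃ = d − 2` and
`ρ + a + 1 = d` this is `k₂ + k₃ ≥ a − 1`. -/
theorem soloLie_untwist_k_sum (d a ρ d₂ d₃ k₂ k₃ : ℕ) (hρ : ρ + a + 1 = d) (hsum : d₂ + d₃ + 2 = d)
    (hk₂ : 2 * d₂ ≤ 2 * k₂ + ρ) (hk₃ : 2 * d₃ ≤ 2 * k₃ + ρ) : a ≤ k₂ + k₃ + 1 := by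
  omega

/-- Theorem 13, main branch: two pair bounds of Lemma 2.1 in `A` (`x + kᵢ ≤ a − 1`) and (13.0) give
`2x ≤ a − 1`. -/
theorem soloLie_untwist_two_slices (a x k₂ k₃ : ℕ) (h23 : a ≤ k₂ + k₃ + 1)
    (h2 : x + k₂ + 1 ≤ a) (h3 : x + k₃ + 1 ≤ a) : 2 * x + 1 ≤ a := by
  omega

/-- Theorem 13, degenerate branch (`k₃ = 0`, so `k₂ ≥ a − 1`): the injectivity form of Lemma 2.1
(`x + k₂ ≤ a`) and `a ≥ 3` give the same `2x ≤ a − 1`. -/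
theorem soloLie_untwist_degenerate (a x k₂ : ℕ) (ha : 3 ≤ a) (hk₂ : a ≤ k₂ + 1)
    (hinj : x + k₂ ≤ a) : 2 * x + 1 ≤ a := by
  omega

/-- Theorem 13, conclusion: slice dimension `x ≥ d₁ − ε − ρ/2` (`ε = 0` pinned/untwisted, `ε = 1`
plain level sets) and `2x ≤ a − 1` give `2d₁ ≤ d − 2 + 2ε`, i.e. `d₁ ≤ d/2 − 1 + ε`. -/
theorem soloLie_untwist_dim_bound (d a r d₁ x ε : ℕ) (hρ : 2 * r + a + 1 = d)
    (hx : d₁ ≤ x + ε + r) (h2x : 2 * x + 1 ≤ a) : 2 * d₁ + 2 ≤ d + 2 * ε := by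
  omega

/-- Theorem 13 in `GL₄(ℝ)` (`d = 16`): untwisted or pinned (`ε = 0`) third members have `d₁ ≤ 7`,
hence `Σ = d₁ + 7 + 7 ≤ 21 = F(GL₄(ℝ))` — no `(8,7,7)` over a codimension-2 subgroup pair with (UH). -/
theorem soloLie_untwist_gl4 (a r d₁ x : ℕ) (hρ : 2 * r + a + 1 = 16) (hx : d₁ ≤ x + r)
    (h2x : 2 * x + 1 ≤ a) : d₁ ≤ 7 ∧ d₁ + 7 + 7 ≤ 21 := by
  omega

/-- Theorem 13(iii) (the Theorem 12 branch): `Σ = d − 2 + d₁ ≤ (3d − ι)/2 − 1` gives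
`2d₁ ≤ d − ι + 2`; for `d = 16, ι = 4`: `d₁ ≤ 7`. -/
theorem soloLie_untwist_thm12_branch (d ι d₁ : ℤ) (hS : 2 * (d - 2 + d₁) ≤ 3 * d - ι - 2) :
    2 * d₁ ≤ d - ι + 2 ∧ (d = 16 → ι = 4 → d₁ ≤ 7) := by
  constructor
  · linarith
  · intro hd hι; subst hd; subst hι; linarith

/-- Corollary 13.1 ((Q_L7) = NO): in the moving case the untwisted slice is a point because
`A₀ ⊂ H₃H₂` (`x = 0`, `ρ₀ = 12`), so `d₁ ≤ 6`; in the pinned case `d₁ ≤ 7`; either way no `8`. -/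
theorem soloLie_untwist_QL7 (d₁ x : ℕ) (hcase : (x = 0 ∧ d₁ ≤ x + 6) ∨ d₁ + 7 ≤ 16 - 2) :
    d₁ ≤ 7 ∧ ¬ (d₁ = 8) := by
  omega

/-- Corollary 13.2 (census table): every invariant signature `(a₀; k₂, k₃)` met by the exact census,
with untwisted slice `σ = (a₀+1)/2`, violates a pair bound `σ + kᵢ ≤ a₀ − 1` of Lemma 2.1. -/
theorem soloLie_untwist_census_table :
    ∀ p ∈ [(3,1,1), (3,2,1), (5,2,2), (5,3,2), (7,3,3), (7,4,3), (9,4,4), (9,5,4), (11,5,5)],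
      (fun (q : ℕ × ℕ × ℕ) => q.1 < (q.1 + 1) / 2 + max q.2.1 q.2.2 + 1 + 1 ∧ 1 ≤ min q.2.1 q.2.2) p := by
  decide

/-- Remark 13.4(2): under (UH) codimension-2 subgroup-pair templates have `Σ ≤ 3d/2 − 3`, strictly
below the threshold `(3d − ι)/2` whenever `ι ≤ 5`. -/
theorem soloLie_untwist_below_threshold (d ι : ℤ) (hι : ι ≤ 5) : 3 * d - 6 < 3 * d - ι := by
  linarith

end Counting

end Summit.MatrixMultiplication.MatrixMultiplication.Theorems
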